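import Summits.BirchSwinnertonDyer.BirchSwinnertonDyer.Theorems.GenusKolyvaginAtTwoGenusPrimitiveSupplyAtTwoGenusIdentity
import Summits.BirchSwinnertonDyer.BirchSwinnertonDyer.Theorems.KolyvaginRoadThreeLevelData
import Summits.BirchSwinnertonDyer.Rank1Residual.Partition.MainConjecturesCMInert
import Literature.NumberTheory.EllipticCurves.HeegnerTraceRelationProofs
import Literature.NumberTheory.EllipticCurves.RingClassGalOverCardinality
import Literature.NumberTheory.EllipticCurves.RingClassFieldAbelian
import Literature.NumberTheory.EllipticCurves.HeegnerHypothesisKroneckerProofs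
import Literature.NumberTheory.EllipticCurves.ModularityVersionApProofs
import HarnessLib

/-!
# Crux `CMKolyvaginConjectureAtInertTwo` (stmt-BirchSwinnertonDyer-24648), line `birth`, open stub
# `stub_positiveDepth`: THE GENUS-TRACE FORM AT EVERY LEVEL — `P(n) ≡ ± Σ_s s(𝒩_n y(n)) (mod 2E(K[n]))`

Route `CMKolyvaginAtInertTwo` (cell `pub/bsd-eis`, seat `leafhand-bsd-cmkolyvaginatinert-1` g0); helper (`--supports
stmt-BirchSwinnertonDyer-24648`). THEOREMS ONLY (no definition, no named fact, no `sorry`); closes nothing; BSD is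
proved for no curve. Companion of `…PositiveDepthPrimeLevel.lean` (prime level); this file treats EVERY square-free
CM-inert Kolyvagin level `n`, with NO torsion hypothesis.

WHAT. `stub_positiveDepth` (Kolyvagin's conjecture at `p = 2` on H₂ in positive depth) asks for a square-free product
`n` of Zhang–Kolyvagin primes at `2` inert in `F` and a datum `d` with `P(n) ∉ 2E(K[n])`. On H₂ the derived point is,
modulo `2E(K[n])`, a GENUS TRACE:

* §1 (pure algebra, any monoid acting on an additive group) `foldr_oddPart_eq_sign_zsmul_foldr_normPart`: for pairwise
  commuting `σ_q` (`q ∈ L`, all odd) and `y` with every partial trace `Σ_{i ≤ q} σ_q^i y = 0`, GenusKoly's odd-part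
  operator equals `(−1)^{|L|}` times the NORM PART `𝒩_L = ∏_{q ∈ L} Σ_{k < (q+1)/2} σ_q^{2k}` on `y`
  (`sum_pow_foldr_normPart_comm`: power sums of `σ_ℓ` commute with `𝒩_L`; `map_normPart_eq_neg_of_trace_eq_zero`:
  `σ N z = −N z` when `Tr z = 0`).
* §2 `sum_range_pointGalHom_σ_pow_y_eq_zero_of_mem_primeFactors` — on an H₂ frame (CM, `K` with odd `d_K ≠ −3`, Heegner
  for `N_E`) at a square-free level `n` with CM-inert Zhang–Kolyvagin prime factors, EVERY partial trace vanishes: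
  `Σ_{i ≤ ℓ} σ_ℓ^i y(n) = a_ℓ · y(n/ℓ) = 0` (Gross Prop. 3.7 (1) = tree THEOREM
  `HeegnerTrace.finsum_mem_ringClassGalOver_eq_frobeniusTrace_smul`; Deuring `a_ℓ = 0` =
  `Rank1Residual.frobeniusTrace_eq_zero_of_hasCM_of_cmInert`; `#G_ℓ = ℓ + 1` = `RingClassField.card_ringClassGalOver_div_eq_succ`);
  `commute_σ_of_mem_primeFactors` (`𝒢_n` abelian, tree `commute_of_mem_ringClassGal`).
* §3 **`two_dvd_derivedPoint_iff_two_dvd_genusTrace`**: `P(n) ∈ 2E(K[n]) ⟺ Σ_{s ∈ S} s(𝒩_n y(n)) ∈ 2E(K[n])`, where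
  `𝒩_n y(n)` is the norm of `y(n)` from `K[n]` to the genus `2`-layer `L_n` (fixed field of `⟨σ_ℓ² : ℓ ∣ n⟩`,
  `[L_n : K[1]] = 2^{ν(n)}`); with GenusKoly's `heegner_exists_two_zsmul_eq_derivedPoint_iff_oddPart`.
  Consequences: `genusTrace_primitive_of_derivedPoint_primitive` and **`stub_positiveDepth_of_genusTrace`** — the
  registered signature of `stub_positiveDepth` VERBATIM is EQUIVALENT, frame by frame, to «some square-free CM-inert
  Kolyvagin level `n` carries a datum whose genus trace `Σ_s s(𝒩_n y(n))` is not `2`-divisible in `E(K[n])`».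

HONEST FRAMING: a composition of tree theorems (routes GenusKolyvaginAtTwo / KolyvaginRoadThree / Gross 1991 typers);
the open mathematics is untouched and now reads: `2`-indivisibility of a genus trace of a higher-conductor Heegner point
on a CM curve — Kolyvagin's non-vanishing at `2`, no printed source. No item is closed; BSD is proved for no curve.

References: [cite: GrossLMS1991, §3 (3.5), Prop. 3.7 (1); §4 (4.1)] [cite: WZhang2014, §3.7, Notations (xii)]
[cite: Lang1987, Ch. 13 §4 Thm. 12] [cite: Cox2013, §9.A].
-/

set_option linter.dupNamespace false -- `Summit.BirchSwinnertonDyer.BirchSwinnertonDyer.Theorems.…` (summit = sub)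
set_option autoImplicit false

noncomputable section

open scoped Classical

namespace Summit.BirchSwinnertonDyer.BirchSwinnertonDyer.Theorems.CMKolyvaginConjecturePositiveDepth

open Finset Literature.NumberTheory.EllipticCurves Literature.NumberTheory.EllipticCurves.KolyvaginOperator

section Algebra

variable {G : Type*} [Monoid G] {A : Type*} [AddCommGroup A] (ρ : G →* AddMonoid.End A)

/-- **A power sum of `σ_ℓ` commutes with the norm-part operator of a list of commuting `σ`'s.** [folklore] -/
theorem sum_pow_foldr_normPart_comm (σ : ℕ → G) (ℓ : ℕ) (I : Finset ℕ) (L : List ℕ)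
    (hcomm : ∀ q ∈ L, Commute (σ ℓ) (σ q)) (y : A) :
    ∑ i ∈ I, ρ (σ ℓ ^ i) (L.foldr (fun q x ↦ ∑ k ∈ range ((q + 1) / 2), ρ ((σ q ^ 2) ^ k) x) y) =
      L.foldr (fun q x ↦ ∑ k ∈ range ((q + 1) / 2), ρ ((σ q ^ 2) ^ k) x) (∑ i ∈ I, ρ (σ ℓ ^ i) y) := by
  induction L with
  | nil => simp
  | cons q L ih =>
    simp only [List.foldr_cons]
    rw [← ih (fun q' hq' ↦ hcomm q' (List.mem_cons_of_mem q hq'))]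
    simp only [map_sum, Finset.sum_comm (s := I)]
    refine Finset.sum_congr rfl fun k _ ↦ Finset.sum_congr rfl fun i _ ↦ ?_
    have h := ((((hcomm q List.mem_cons_self).pow_left i).pow_right 2).pow_right k).eq
    have h' := congrArg (fun g ↦ ρ g (List.foldr (fun q x ↦ ∑ k ∈ range ((q + 1) / 2), ρ ((σ q ^ 2) ^ k) x) y L)) h
    simp only [map_mul] at h'
    exact h'

/-- **`σ N z = −N z` when `Tr z = 0`**: for odd `ℓ`, `N = Σ_{k<(ℓ+1)/2} (σ²)^k` and `Tr = Σ_{i≤ℓ} σ^i = N + σN`. [folklore] -/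
theorem map_normPart_eq_neg_of_trace_eq_zero (τ : G) {ℓ : ℕ} (hℓ : Odd ℓ) (z : A)
    (htr : ∑ i ∈ range (ℓ + 1), ρ (τ ^ i) z = 0) :
    ρ τ (∑ k ∈ range ((ℓ + 1) / 2), ρ ((τ ^ 2) ^ k) z) = -∑ k ∈ range ((ℓ + 1) / 2), ρ ((τ ^ 2) ^ k) z := by
  have h2 : (ℓ + 2) / 2 = (ℓ + 1) / 2 := by obtain ⟨r, hr⟩ := hℓ; omega
  rw [← Finset.sum_filter_add_sum_filter_not (range (ℓ + 1)) Even] at htr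
  simp only [Nat.not_even_iff_odd] at htr
  have heven : ∑ i ∈ (range (ℓ + 1)).filter Even, ρ (τ ^ i) z = ∑ k ∈ range ((ℓ + 2) / 2), ρ ((τ ^ 2) ^ k) z := by
    have himage : (range (ℓ + 1)).filter Even = (range ((ℓ + 2) / 2)).image (fun k ↦ 2 * k) := by
      ext i
      simp only [Finset.mem_filter, Finset.mem_range, Finset.mem_image]
      constructor
      · rintro ⟨hi, ⟨k, rfl⟩⟩
        exact ⟨k, by omega, by omega⟩
      · rintro ⟨k, hk, rfl⟩
        exact ⟨by omega, ⟨k, by omega⟩⟩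
    rw [himage, Finset.sum_image (fun a _ b _ h ↦ by omega)]
    refine Finset.sum_congr rfl fun k _ ↦ ?_
    rw [← pow_mul]
  rw [heven, h2, GenusKoly.sum_filter_odd_eq_map_sum_sq_pow] at htr
  exact eq_neg_of_add_eq_zero_right htr

/-- The norm-part operator of any list sends `0` to `0`. [folklore] -/
theorem foldr_normPart_zero (σ : ℕ → G) (L : List ℕ) :
    L.foldr (fun q x ↦ ∑ k ∈ range ((q + 1) / 2), ρ ((σ q ^ 2) ^ k) x) (0 : A) = 0 := by
  induction L with
  | nil => simp
  | cons q L ih =>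
    rw [List.foldr_cons, ih]
    simp only [map_zero, Finset.sum_const_zero]

/-- **Odd part = ± norm part when every partial trace vanishes**: for pairwise commuting `σ_q`, a list `L` of odd
`q`'s, and `y` with `Σ_{i≤q} σ_q^i y = 0` for all `q ∈ L`:
`∏_{q∈L}(Σ_{i odd ≤ q} σ_q^i) y = (−1)^{|L|} ∏_{q∈L}(Σ_{k<(q+1)/2} σ_q^{2k}) y`. [folklore] -/
theorem foldr_oddPart_eq_sign_zsmul_foldr_normPart (σ : ℕ → G) (L : List ℕ)
    (hcomm : ∀ q ∈ L, ∀ q' ∈ L, Commute (σ q) (σ q')) (hodd : ∀ q ∈ L, Odd q) (y : A)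
    (htr : ∀ q ∈ L, ∑ i ∈ range (q + 1), ρ (σ q ^ i) y = 0) :
    L.foldr (fun q x ↦ ∑ i ∈ (range (q + 1)).filter Odd, ρ (σ q ^ i) x) y =
      ((-1 : ℤ) ^ L.length) • L.foldr (fun q x ↦ ∑ k ∈ range ((q + 1) / 2), ρ ((σ q ^ 2) ^ k) x) y := by
  induction L with
  | nil => simp
  | cons q L ih =>
    have hL : ∀ q' ∈ L, Odd q' := fun q' hq' ↦ hodd q' (List.mem_cons_of_mem q hq')
    have hLc : ∀ q' ∈ L, ∀ q'' ∈ L, Commute (σ q') (σ q'') :=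
      fun q' hq' q'' hq'' ↦ hcomm q' (List.mem_cons_of_mem q hq') q'' (List.mem_cons_of_mem q hq'')
    have hLtr : ∀ q' ∈ L, ∑ i ∈ range (q' + 1), ρ (σ q' ^ i) y = 0 :=
      fun q' hq' ↦ htr q' (List.mem_cons_of_mem q hq')
    simp only [List.foldr_cons, List.length_cons]
    rw [ih hLc hL hLtr, GenusKoly.sum_filter_odd_eq_map_sum_sq_pow]
    set z := L.foldr (fun q x ↦ ∑ k ∈ range ((q + 1) / 2), ρ ((σ q ^ 2) ^ k) x) y with hz
    -- the partial trace of `z` at `q` vanishes (commute the power sum past the norm parts)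
    have hzq : ∑ i ∈ range (q + 1), ρ (σ q ^ i) z = 0 := by
      rw [hz, sum_pow_foldr_normPart_comm ρ σ q (range (q + 1)) L
        (fun q' hq' ↦ hcomm q List.mem_cons_self q' (List.mem_cons_of_mem q hq')) y,
        htr q List.mem_cons_self, foldr_normPart_zero]
    have hpull : ∑ k ∈ range ((q + 1) / 2), ρ ((σ q ^ 2) ^ k) (((-1 : ℤ) ^ L.length) • z) =
        ((-1 : ℤ) ^ L.length) • ∑ k ∈ range ((q + 1) / 2), ρ ((σ q ^ 2) ^ k) z := by
      rw [Finset.smul_sum]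
      simp only [map_zsmul]
    rw [hpull, map_zsmul, map_normPart_eq_neg_of_trace_eq_zero ρ (σ q) (hodd q List.mem_cons_self) z hzq,
      smul_neg, show ((-1 : ℤ) ^ (L.length + 1)) = -((-1) ^ L.length) by ring, neg_smul]

end Algebra

section Heegner

open WeierstrassCurve NumberField Literature.NumberTheory.EllipticCurves.ModularForms
  Literature.NumberTheory.EllipticCurves.Rank1Residual Summit.BirchSwinnertonDyer.BirchSwinnertonDyer.Theorems

variable {K : Type} [Field K] [NumberField K]

/-- `Σᶠ` over the cyclic group `⟨x⟩` of order `k` is the sum over the powers `x^0, …, x^{k−1}`. [folklore] -/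
private theorem finsum_mem_zpowers_eq_sum_range' {G : Type*} [Group G] {M : Type*} [AddCommMonoid M]
    (x : G) {k : ℕ} (hk : orderOf x = k) (hk0 : k ≠ 0) (f : G → M) :
    ∑ᶠ g ∈ (Subgroup.zpowers x : Set G), f g = ∑ i ∈ Finset.range k, f (x ^ i) := by
  classical
  have hfin : IsOfFinOrder x := orderOf_pos_iff.mp (by omega)
  have hset : (Subgroup.zpowers x : Set G) = ↑((Finset.range k).image (x ^ ·)) := by
    ext g
    rw [SetLike.mem_coe, hfin.mem_zpowers_iff_mem_range_orderOf, hk, Finset.mem_coe]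
  rw [hset, finsum_mem_coe_finset, Finset.sum_image]
  intro i hi j hj hij
  exact pow_injOn_Iio_orderOf (Set.mem_Iio.mpr (hk ▸ Finset.mem_range.mp hi))
    (Set.mem_Iio.mpr (hk ▸ Finset.mem_range.mp hj)) hij

/-- `d_K < −4` for an imaginary quadratic field of odd discriminant `≠ −3`. [folklore] -/
private theorem discr_lt_neg_four' (hK : IsImaginaryQuadratic K) (hodd : Odd (NumberField.discr K))
    (h3 : NumberField.discr K ≠ -3) : NumberField.discr K < -4 := by
  have hgt : 2 < |NumberField.discr K| := NumberField.abs_discr_gt_two (by rw [hK.1]; exact one_lt_two)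
  have hneg : NumberField.discr K < 0 := hK.discr_neg
  rw [abs_of_neg hneg] at hgt
  obtain ⟨r, hr⟩ := hodd
  omega

/-- **At a square-free CM-inert Kolyvagin level EVERY partial trace of `y(n)` vanishes**: for `W/ℚ` globally minimal
with CM, `K` imaginary quadratic with odd `d_K ≠ −3` and Heegner for `N_E`, a datum `d` of square-free conductor `n` all
of whose prime factors are Zhang–Kolyvagin primes at `2` inert in `F`, and `ℓ ∣ n`: `Σ_{i ≤ ℓ} σ_ℓ^i y(n) = 0` in
`E(K[n])` — Gross's Prop. 3.7 (1) `Tr_ℓ y_n = a_ℓ y_{n/ℓ}` (tree THEOREM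
`HeegnerTrace.finsum_mem_ringClassGalOver_eq_frobeniusTrace_smul`) with Deuring's `a_ℓ = 0`, `#G_ℓ = ℓ + 1`.
[cite: GrossLMS1991, §3 Prop. 3.7 (1)] [cite: Lang1987, Ch. 13 §4 Thm. 12] -/
theorem sum_range_pointGalHom_σ_pow_y_eq_zero_of_mem_primeFactors (W : WeierstrassCurve ℚ) [W.IsElliptic]
    [W.IsGloballyMinimal] [NeZero (W.conductorNorm ℤ)] (hCM : W.HasCM) (hK : IsImaginaryQuadratic K)
    (hodd : Odd (NumberField.discr K)) (h3 : NumberField.discr K ≠ -3)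
    (hH : SatisfiesHeegnerHypothesis (W.conductorNorm ℤ) K)
    {Dt : ModularParametrizationData W (W.conductorNorm ℤ)} {β : ℤ} {ι : K →+* ℂ} {n : ℕ} (hn : Squarefree n)
    (hKol : ∀ ℓ ∈ n.primeFactors, Zhang2014.IsKolyvaginPrime (W.conductorNorm ℤ) W K 2 ℓ ∧ CMInert W ℓ)
    (d : KolyvaginHeegnerData Dt β ι n) {ℓ : ℕ} (hℓn : ℓ ∈ n.primeFactors) :
    ∑ i ∈ range (ℓ + 1), pointGalHom W (ringClassField K ι n) (d.σ ℓ ^ i) d.y = 0 := by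
  obtain ⟨⟨hℓ, hℓN, -, hℓ2, hinert, -⟩, hℓF⟩ := hKol ℓ hℓn
  haveI : Fact ℓ.Prime := ⟨hℓ⟩
  have hn0 : n ≠ 0 := hn.ne_zero
  have hℓdvd : ℓ ∣ n := Nat.dvd_of_mem_primeFactors hℓn
  have hℓm : ¬ ℓ ∣ n / ℓ := fun h ↦ by
    have h2 : ℓ * ℓ ∣ n := by
      rw [← Nat.mul_div_cancel' hℓdvd]
      exact Nat.mul_dvd_mul_left ℓ h
    exact hℓ.one_lt.ne' (Nat.isUnit_iff.mp (hn ℓ h2))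
  have hm : n / ℓ ≠ 0 := fun h ↦ hn0 (by rw [← Nat.mul_div_cancel' hℓdvd, h, mul_zero])
  have hND : IsCoprime (W.conductorNorm ℤ : ℤ) (NumberField.discr K) := by
    have h := Literature.SatisfiesHeegnerHypothesis.coprime_discr hK.1 hH
    refine Int.isCoprime_iff_gcd_eq_one.mpr ?_
    rw [Int.gcd_eq_natAbs, Int.natAbs_natCast]
    exact h
  have hcop : Nat.Coprime n (W.conductorNorm ℤ) :=
    coprime_of_primeFactors_inert hH hn0 (fun q hq ↦ (hKol q hq).1.2.2.2.2.1)
  have hNm : Nat.Coprime (W.conductorNorm ℤ) (n / ℓ) :=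
    (Nat.Coprime.coprime_dvd_left (Nat.div_dvd_of_dvd hℓdvd) hcop).symm
  have hD := discr_lt_neg_four' hK hodd h3
  -- Gross's Prop. 3.7 (1) at the pair `(n, n/ℓ)`, read in `E(ℂ)`, with `a_ℓ = 0`
  have htr := HeegnerTrace.finsum_mem_ringClassGalOver_eq_frobeniusTrace_smul hK ι Dt hND d.dvd_sq_sub hℓ
    hinert hℓN hℓm hm hNm (Or.inr hD) (Nat.mul_div_cancel' hℓdvd) d.map_y
  have hgood : W.HasGoodReductionAtPrime ℓ :=
    not_not.mp (mt (W.dvd_conductorNorm_iff_not_hasGoodReductionAtPrime ℓ).mpr hℓN)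
  rw [Summit.BirchSwinnertonDyer.Rank1Residual.frobeniusTrace_eq_zero_of_hasCM_of_cmInert hCM hℓ2 hgood hℓF,
    zero_zsmul] at htr
  -- `G_ℓ = ⟨σ_ℓ⟩` of order `ℓ + 1`
  have hz : (Subgroup.zpowers (d.σ ℓ) : Set (ringClassField K ι n ≃ₐ[ℚ] ringClassField K ι n)) =
      (ringClassGalOver ι n (n / ℓ) : Set (ringClassField K ι n ≃ₐ[ℚ] ringClassField K ι n)) := by
    rw [d.zpowers_σ ℓ hℓn]
  have hord : orderOf (d.σ ℓ) = ℓ + 1 := by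
    rw [← Nat.card_zpowers, d.zpowers_σ ℓ hℓn]
    exact RingClassField.card_ringClassGalOver_div_eq_succ hK ι hℓ hinert hℓdvd hℓm hn0 (Or.inr hD)
  rw [← hz, finsum_mem_zpowers_eq_sum_range' (d.σ ℓ) hord (Nat.succ_ne_zero ℓ), ← map_sum] at htr
  exact WeierstrassCurve.Affine.Point.map_injective (W' := W) (ringClassField K ι n).subtype.toRatAlgHom
    (htr.trans (map_zero _).symm)

/-- The generators `σ_q`, `q ∣ n`, of a datum commute (`𝒢_n = Gal(K[n]/K)` is abelian, tree
`commute_of_mem_ringClassGal`; `σ_q ∈ G_q ≤ 𝒢_n`). [cite: GrossLMS1991, §3 (𝒢_n)] [cite: Cox2013, §9.A] -/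
theorem commute_σ_of_mem_primeFactors (W : WeierstrassCurve ℚ) {N : ℕ} [NeZero N] (hK : IsImaginaryQuadratic K)
    {Dt : ModularParametrizationData W N} {β : ℤ} {ι : K →+* ℂ} {n : ℕ} (hn : n ≠ 0)
    (d : KolyvaginHeegnerData Dt β ι n) {q q' : ℕ} (hq : q ∈ n.primeFactors) (hq' : q' ∈ n.primeFactors) :
    Commute (d.σ q) (d.σ q') := by
  have hmem : ∀ {p : ℕ}, p ∈ n.primeFactors → d.σ p ∈ ringClassGal ι n := fun {p} hp ↦
    ringClassGalOver_le_ringClassGal ι n (n / p) (by rw [← d.zpowers_σ p hp]; exact Subgroup.mem_zpowers _)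
  exact commute_of_mem_ringClassGal hK hn (hmem hq) (hmem hq')

/-- **THE GENUS-TRACE FORM OF THE STUB AT EVERY LEVEL, no torsion hypothesis.** Same standing hypotheses; for a
datum `d` of square-free conductor `n` with CM-inert Zhang–Kolyvagin prime factors:
**`P(n) ∈ 2E(K[n]) ⟺ Σ_{s ∈ S} s(𝒩_n y(n)) ∈ 2E(K[n])`**, `𝒩_n = ∏_{ℓ ∣ n} Σ_{k < (ℓ+1)/2} σ_ℓ^{2k}` the NORM of
`K[n]` down to the genus `2`-layer `L_n` (the fixed field of `⟨σ_ℓ² : ℓ ∣ n⟩`, `[L_n : K[1]] = 2^{ν(n)}`), taken along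
`n.primeFactorsList`. Ingredients: GenusKoly's `P(n) ≡ G(n) (mod 2)` (`heegner_exists_two_zsmul_eq_derivedPoint_iff_oddPart`),
the vanishing of every partial trace (above), commutativity of the `σ_ℓ`, and `G(n) = ± 𝒩_n y(n)`
(`foldr_oddPart_eq_sign_zsmul_foldr_normPart`). [cite: GrossLMS1991, §3 (3.5), Prop. 3.7 (1), §4 (4.1)] -/
theorem two_dvd_derivedPoint_iff_two_dvd_genusTrace (W : WeierstrassCurve ℚ) [W.IsElliptic]
    [W.IsGloballyMinimal] [NeZero (W.conductorNorm ℤ)] (hCM : W.HasCM) (hK : IsImaginaryQuadratic K)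
    (hodd : Odd (NumberField.discr K)) (h3 : NumberField.discr K ≠ -3)
    (hH : SatisfiesHeegnerHypothesis (W.conductorNorm ℤ) K)
    {Dt : ModularParametrizationData W (W.conductorNorm ℤ)} {β : ℤ} {ι : K →+* ℂ} {n : ℕ} (hn : Squarefree n)
    (hKol : ∀ ℓ ∈ n.primeFactors, Zhang2014.IsKolyvaginPrime (W.conductorNorm ℤ) W K 2 ℓ ∧ CMInert W ℓ)
    (d : KolyvaginHeegnerData Dt β ι n) :
    (∃ Q : (W.baseChange (ringClassField K ι n)).toAffine.Point, (2 : ℤ) • Q = d.derivedPoint) ↔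
      ∃ Q : (W.baseChange (ringClassField K ι n)).toAffine.Point, (2 : ℤ) • Q =
        ∑ s ∈ d.S, pointGalHom W (ringClassField K ι n) s
          (n.primeFactorsList.foldr
            (fun ℓ x ↦ ∑ k ∈ range ((ℓ + 1) / 2), pointGalHom W (ringClassField K ι n) ((d.σ ℓ ^ 2) ^ k) x) d.y) := by
  have hn0 : n ≠ 0 := hn.ne_zero
  have hmem : ∀ q ∈ n.primeFactorsList, q ∈ n.primeFactors := fun q hq ↦ Nat.mem_primeFactors_iff_mem_primeFactorsList.mpr hq
  rw [GenusKoly.heegner_exists_two_zsmul_eq_derivedPoint_iff_oddPart d,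
    foldr_oddPart_eq_sign_zsmul_foldr_normPart (pointGalHom W (ringClassField K ι n)) d.σ n.primeFactorsList
      (fun q hq q' hq' ↦ commute_σ_of_mem_primeFactors W hK hn0 d (hmem q hq) (hmem q' hq'))
      (fun q hq ↦ (hKol q (hmem q hq)).1.1.odd_of_ne_two (hKol q (hmem q hq)).1.2.2.2.1) d.y
      (fun q hq ↦ sum_range_pointGalHom_σ_pow_y_eq_zero_of_mem_primeFactors W hCM hK hodd h3 hH hn hKol d (hmem q hq))]
  simp only [map_zsmul, ← Finset.smul_sum]
  rcases neg_one_pow_eq_or ℤ n.primeFactorsList.length with h | h <;> rw [h]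
  · rw [one_smul]
  · rw [neg_one_smul]
    constructor
    · rintro ⟨Q, hQ⟩
      exact ⟨-Q, by rw [smul_neg, hQ, neg_neg]⟩
    · rintro ⟨Q, hQ⟩
      exact ⟨-Q, by rw [smul_neg, hQ]⟩

/-- **A `2`-primitive derived point certifies a `2`-primitive genus trace** (same frame; immediate from
`two_dvd_derivedPoint_iff_two_dvd_genusTrace`): any witness `(n, d)` of the conclusion of `stub_positiveDepth` ∕ of
crux 24648 has `Σ_{s ∈ S} s(𝒩_n y(n)) ∉ 2E(K[n])`. [cite: GrossLMS1991, §4 (4.1)] -/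
theorem genusTrace_primitive_of_derivedPoint_primitive (W : WeierstrassCurve ℚ) [W.IsElliptic]
    [W.IsGloballyMinimal] [NeZero (W.conductorNorm ℤ)] (hCM : W.HasCM) (hK : IsImaginaryQuadratic K)
    (hodd : Odd (NumberField.discr K)) (h3 : NumberField.discr K ≠ -3)
    (hH : SatisfiesHeegnerHypothesis (W.conductorNorm ℤ) K)
    {Dt : ModularParametrizationData W (W.conductorNorm ℤ)} {β : ℤ} {ι : K →+* ℂ} {n : ℕ} (hn : Squarefree n)
    (hKol : ∀ ℓ ∈ n.primeFactors, Zhang2014.IsKolyvaginPrime (W.conductorNorm ℤ) W K 2 ℓ ∧ CMInert W ℓ)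
    (d : KolyvaginHeegnerData Dt β ι n)
    (hprim : ¬ ∃ Q : (W.baseChange (ringClassField K ι n)).toAffine.Point, (2 : ℤ) • Q = d.derivedPoint) :
    ¬ ∃ Q : (W.baseChange (ringClassField K ι n)).toAffine.Point, (2 : ℤ) • Q =
        ∑ s ∈ d.S, pointGalHom W (ringClassField K ι n) s
          (n.primeFactorsList.foldr
            (fun ℓ x ↦ ∑ k ∈ range ((ℓ + 1) / 2), pointGalHom W (ringClassField K ι n) ((d.σ ℓ ^ 2) ^ k) x) d.y) :=
  fun h ↦ hprim ((two_dvd_derivedPoint_iff_two_dvd_genusTrace W hCM hK hodd h3 hH hn hKol d).mpr h)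

/-- **`stub_positiveDepth` of crux 24648 ⟸ a `2`-primitive GENUS TRACE at some CM-inert Kolyvagin level** (the
registered signature VERBATIM as conclusion): if on every positive-depth H₂ frame some square-free product `n` of
Zhang–Kolyvagin primes at `2` inert in `F` carries a datum `d` with `Σ_{s ∈ S} s(𝒩_n y(n)) ∉ 2E(K[n])`, the stub holds
(same `n`, same `d`). With `genusTrace_primitive_of_derivedPoint_primitive` the two statements are EQUIVALENT frame by
frame. [cite: GrossLMS1991, §3 (3.5), Prop. 3.7 (1), §4 (4.1)] [cite: WZhang2014, §3.7, Notations (xii)] -/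
theorem stub_positiveDepth_of_genusTrace
    (hgen : ∀ (W : WeierstrassCurve ℚ) [W.IsElliptic] [W.IsGloballyMinimal] [NeZero (W.conductorNorm ℤ)], W.HasCM → Literature.NumberTheory.EllipticCurves.Rank1Residual.CMInert W 2 → W.HasSurjectiveModNGaloisRep (2 : ℤ) → W.analyticRank = 1 → Odd W.tamagawaProduct → ∀ (K : Type) [Field K] [NumberField K], Literature.NumberTheory.EllipticCurves.IsImaginaryQuadratic K → Odd (NumberField.discr K) → NumberField.discr K ≠ -3 → Literature.NumberTheory.EllipticCurves.SatisfiesHeegnerHypothesis (W.conductorNorm ℤ) K → ∀ (Dt : Literature.NumberTheory.EllipticCurves.ModularForms.ModularParametrizationData W (W.conductorNorm ℤ)), (∀ z ∈ Dt.L.lattice, ∃ w ∈ Literature.NumberTheory.EllipticCurves.ModularForms.periodLattice Dt.f, z = (Dt.c : ℂ) * w) → Odd Dt.c → ∀ (β : ℤ) (ι : K →+* ℂ) (d₁ : Literature.NumberTheory.EllipticCurves.KolyvaginHeegnerData Dt β ι 1), ¬ IsOfFinAddOrder d₁.derivedPoint → (∃ Q : (W.baseChange (Literature.NumberTheory.EllipticCurves.ringClassField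 K ι 1)).toAffine.Point, (2 : ℤ) • Q = d₁.derivedPoint) →
      ∃ (n : ℕ) (d : Literature.NumberTheory.EllipticCurves.KolyvaginHeegnerData Dt β ι n), Squarefree n ∧
        (∀ ℓ ∈ n.primeFactors, (Literature.NumberTheory.EllipticCurves.Zhang2014.IsKolyvaginPrime (W.conductorNorm ℤ) W K 2 ℓ ∧
          Literature.NumberTheory.EllipticCurves.Rank1Residual.CMInert W ℓ)) ∧
        ¬ ∃ Q : (W.baseChange (Literature.NumberTheory.EllipticCurves.ringClassField K ι n)).toAffine.Point, (2 : ℤ) • Q =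
          ∑ s ∈ d.S, Literature.NumberTheory.EllipticCurves.pointGalHom W (Literature.NumberTheory.EllipticCurves.ringClassField K ι n) s
            (n.primeFactorsList.foldr
              (fun ℓ x ↦ ∑ k ∈ Finset.range ((ℓ + 1) / 2),
                Literature.NumberTheory.EllipticCurves.pointGalHom W (Literature.NumberTheory.EllipticCurves.ringClassField K ι n) ((d.σ ℓ ^ 2) ^ k) x) d.y)) :
    ∀ (W : WeierstrassCurve ℚ) [W.IsElliptic] [W.IsGloballyMinimal] [NeZero (W.conductorNorm ℤ)], W.HasCM → Literature.NumberTheory.EllipticCurves.Rank1Residual.CMInert W 2 → W.HasSurjectiveModNGaloisRep (2 : ℤ) → W.analyticRank = 1 → Odd W.tamagawaProduct → ∀ (K : Type) [Field K] [NumberField K], Literature.NumberTheory.EllipticCurves.IsImaginaryQuadratic K → Odd (NumberField.discr K) → NumberField.discr K ≠ -3 → Literature.NumberTheory.EllipticCurves.SatisfiesHeegnerHypothesis (W.conductorNorm ℤ) K → ∀ (Dt : Literature.NumberTheory.EllipticCurves.ModularForms.ModularParametrizationData W (W.conductorNorm ℤ)), (∀ z ∈ Dt.L.lattice, ∃ w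 ∈ Literature.NumberTheory.EllipticCurves.ModularForms.periodLattice Dt.f, z = (Dt.c : ℂ) * w) → Odd Dt.c → ∀ (β : ℤ) (ι : K →+* ℂ) (d₁ : Literature.NumberTheory.EllipticCurves.KolyvaginHeegnerData Dt β ι 1), ¬ IsOfFinAddOrder d₁.derivedPoint → (∃ Q : (W.baseChange (Literature.NumberTheory.EllipticCurves.ringClassField K ι 1)).toAffine.Point, (2 : ℤ) • Q = d₁.derivedPoint) → ∃ (n : ℕ) (d : Literature.NumberTheory.EllipticCurves.KolyvaginHeegnerData Dt β ι n), Squarefree n ∧ (∀ ℓ ∈ n.primeFactors, (Literature.NumberTheory.EllipticCurves.Zhang2014.IsKolyvaginPrime (W.conductorNorm ℤ) W K 2 ℓ ∧ Literature.NumberTheory.EllipticCurves.Rank1Residual.CMInert W ℓ)) ∧ ¬ ∃ Q : (W.baseChange (Literature.NumberTheory.EllipticCurves.ringClassField K ι n)).toAffine.Point, (2 : ℤ) • Q = d.derivedPoint := by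
  intro W _ _ _ hCM hin hρ hr hT K _ _ hK hodd h3 hH Dt hDt hc β ι d₁ hy h2
  obtain ⟨n, d, hn, hKol, hG⟩ := hgen W hCM hin hρ hr hT K hK hodd h3 hH Dt hDt hc β ι d₁ hy h2
  exact ⟨n, d, hn, hKol, fun hP ↦ hG
    ((two_dvd_derivedPoint_iff_two_dvd_genusTrace W hCM hK hodd h3 hH hn hKol d).mp hP)⟩

end Heegner

end Summit.BirchSwinnertonDyer.BirchSwinnertonDyer.Theorems.CMKolyvaginConjecturePositiveDepth

end
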